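import Literature.IUT.HodgeTheaters.GaloisValDatumDivisorPerfection
import Literature.IUT.HodgeArakelov.GMonoidFrobenioidsDef38Proofs
import Literature.AlgebraicGeometry.Frobenioids.PadicFrobenioidZeroMonoid
import Literature.AlgebraicGeometry.Frobenioids.PadicFrobenioidIsFrobenioid
import HarnessLib

/-!
# The model Frobenioid of the GENUINE `G_v`-monoid `𝒪^▷_{K̄_v}` satisfies the hypotheses of [FrdI] Thm. 5.2 — [IUTchII]
# Def. 3.8 (i) «gives rise to a `p_v`-adic Frobenioid» for `F_{†C_v}` / `F_cns` at the genuine constant monoid (proof-only)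

S. Mochizuki, *Inter-universal Teichmüller theory II*, §3, kurims manuscript (Dec. 2020), Definition 3.8 (i) p. 113
l. 2–13 «Each of the monoids equipped with a `Π_X(M^Θ_*)`-action … gives rise to a `p_v`-adic Frobenioid of monoid type
`ℤ` [cf. [FrdII], Example 1.1, (ii)] `F_cns(M^Θ_*)`; `F_{†C_v}` …» [cite: Mochizuki2012, Def 3.8 (i) p.113] (pages = kurims
render IUTchII-kurims-url-5036b4059555; D-0012 claim key, status disputed — nothing of the series is asserted); Mochizuki,
*The geometry of Frobenioids I*, Kyushu J. Math. **62** (2008), Thm. 5.2 p. 100 «Let `Φ` be a divisorial monoid on a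
connected, totally epimorphic category `D`, `B` a group-like monoid on `D` …» [cite: MochizukiFrdI2008, Thm. 5.2 p.100];
*Frobenioids II*, Ex. 1.1 (i) p. 7 / (ii) p. 8 [cite: MochizukiFrdII2008, Ex 1.1 (ii) p.8].

abc-iut cell, seat abc-iut-L6-t7 (gen 4, MERGE-MAP writer); row «B16-iv HYPOTHESES OF THE GENUINE `C_v` COVERING MONOID»
(INTENT 18:50:58Z) — abc-iut-L1-lead's interface condition (2) («“gives rise to a Frobenioid” is honest only if you ALSO
discharge `ModelFrobenioid.Hypotheses Φ B`») at abc-iut-L5-t2's GENUINE `G_v`-monoid `GaloisValDatum.coveringMonoid`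
(p456702), for abc-iut-w4-d019's model Frobenioid data `(divisorFunctor, ratFnFunctor)` (p455796); the companion of
abc-iut-L5-t2's `hypotheses_dashSplitCoveringMonoid` (p461055, the `C⊢_v` split monoid).  PROOF-ONLY (0 defs,
0 instances, no `Prop` fact, no sorry), everything BY NAME: abc-iut-w4-d019's (B) generics `isMonoidOn_divisorFunctor_of`,
`isMonoidOn_ratFnFunctor`, `isGroupLike_ratFnFunctor`, `isGraphConnected_cosetCat` (p457550); this seat's
`divisorEquiv_natural` (p459689) and `isMonoprime_divisorFunctor_obj` (p460905); abc-iut-L1's `ordIntMapOfHom_injective`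
([FrdII] Ex 1.1 (i): pull-backs of `ord(𝒪^▷)` along valuative homomorphisms are injective) and `IsMonoprime.isDivisorial`
([FrdI] Def 1.1 (i)); abc-iut-L5-t2's `CosetCat.isTotallyEpimorphic`.

WHAT IS PROVED (for every `d : GaloisValDatum p`):
* `isCancelMul_coveringMonoid` — `𝒪^▷_{K̄_v}` is cancellative (a submonoid of the nonzero elements of a field);
* `associatesMap_pull_injective_coveringMonoid` — (A)'s divisor-level pull-backs `Φ(G_v/V) → Φ(G_v/U)` of the genuine
  monoid are injective ([FrdI] Def 1.1 (ii)(a) «characteristically injective»: they are `ord(𝒪^▷_{Ω^V}) → ord(𝒪^▷_{Ω^U})`);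
* `isDivisorial_divisorFunctor_obj` — every `Φ(G_v/U) ≅ ord(𝒪^▷_{Ω^U}) ≅ ℤ_{≥0}` is divisorial;
* **`hypotheses_coveringMonoid d : ModelFrobenioid.Hypotheses d.coveringMonoid.divisorFunctor d.coveringMonoid.ratFnFunctor`**
  — `Φ` a divisorial monoid on `D⊢_v = CosetCat G_v`, `B = (𝒪^▷)^gp` a group-like monoid on it, `D⊢_v` connected and totally
  epimorphic: abc-iut-L1-t2's [FrdI] Thm 5.2 theory applies to `d.coveringMonoid.frobenioid` — the monoid-level `F_{†C_v}`
  (≅ `F_cns` under Prop 3.3 (ii)) at the genuine constant monoid is an honest Frobenioid instance.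
HONEST FRAMING: valuation/Galois bookkeeping in OUR kernel over the tree's typed interfaces; the routing of print's
`F_cns(M^Θ_*)` / `F_{†C_v}` to this monoid is the NODES rows IUTchII:Prop3.1(ii)/Prop3.3(ii) (their own status), not asserted;
no side taken on [IUTchIII] Cor. 3.12; typed ≠ proved for anything of [IUTchI–III].
-/

namespace Literature.IUT.HodgeTheaters

open CategoryTheory Opposite Function Literature.AnabelianGeometry.SemiGraphs
  Literature.AlgebraicGeometry.Frobenioids Literature.AlgebraicGeometry.Frobenioids.PadicFrd
  Literature.IUT.HodgeArakelov

universe u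

namespace GaloisValDatum

variable {p : ℕ} [Fact p.Prime] (d : GaloisValDatum.{u} p)

/-- `𝒪^▷_{K̄_v}` (the carrier of the genuine `G_v`-monoid) is cancellative: its elements are nonzero elements of the field
`Ω = K̄_v`. [cite: MochizukiFrdII2008, Ex 1.1 (i) p.7] -/
theorem isCancelMul_coveringMonoid : IsCancelMul d.coveringMonoid.O where
  mul_left_cancel a _ _ h := Subtype.ext (mul_left_cancel₀ a.2.2 (congrArg Subtype.val h))
  mul_right_cancel a _ _ h := Subtype.ext (mul_right_cancel₀ a.2.2 (congrArg Subtype.val h))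

/-- **[FrdI] Def 1.1 (ii)(a) at the genuine monoid**: the divisor-level pull-back `Φ(G_v/V) → Φ(G_v/U)` of (A) along
`f : G_v/U → G_v/V` is injective — under `divisorEquiv` it is abc-iut-L1's `ordIntMapOfHom` along the field functor
(`divisorEquiv_natural`), injective by `ordIntMapOfHom_injective` (valuations are preserved and reflected).
[cite: MochizukiFrdII2008, Ex 1.1 (i) p.7] -/
theorem associatesMap_pull_injective_coveringMonoid {X Y : CosetCat d.Gal} (f : X ⟶ Y) :
    Injective (associatesMap (d.coveringMonoid.pull f)) := fun a b hab => by
  apply (d.divisorEquiv Y).injective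
  apply ordIntMapOfHom_injective (d.fieldFunctor.map f).alg (d.fieldFunctor.map f).isValHom
  rw [← d.divisorEquiv_natural f a, ← d.divisorEquiv_natural f b, hab]

/-- Every divisor monoid `Φ(G_v/U) ≅ ord(𝒪^▷_{Ω^U}) ≅ ℤ_{≥0}` of the genuine monoid is divisorial ([FrdI] Def 1.1 (i); abc-iut-L1's
`IsMonoprime.isDivisorial` on `isMonoprime_divisorFunctor_obj`). [cite: MochizukiFrdI2008, Thm. 5.2 p.100] -/
theorem isDivisorial_divisorFunctor_obj (X : (CosetCat d.Gal)ᵒᵖ) :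
    IsDivisorial (d.coveringMonoid.divisorFunctor.obj X) :=
  (d.isMonoprime_divisorFunctor_obj X).isDivisorial

/-- **The (A) model Frobenioid of the GENUINE `G_v`-monoid `𝒪^▷_{K̄_v}` satisfies [FrdI] Thm 5.2's hypotheses** (abc-iut-L1-lead's
condition (2) at the genuine constant monoid): `Φ = (𝒪^▷_{K̄_v})^•/units` is a divisorial monoid on `D⊢_v = CosetCat G_v`
(pull-backs characteristically injective — `associatesMap_pull_injective_coveringMonoid`; FSM-morphisms are isomorphisms over
`CosetCat`), `B = ((𝒪^▷_{K̄_v})^•)^gp` is a group-like monoid on it (`𝒪^▷` cancellative), and `D⊢_v` is connected and totally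
epimorphic — so [IUTchII] Def 3.8 (i)'s «gives rise to a `p_v`-adic Frobenioid … `F_{†C_v}`» is, at the genuine producer and the
monoid level, an honest instance of abc-iut-L1-t2's [FrdI] Thm 5.2 model Frobenioid. [cite: Mochizuki2012, Def 3.8 (i) p.113] -/
theorem hypotheses_coveringMonoid :
    ModelFrobenioid.Hypotheses d.coveringMonoid.divisorFunctor d.coveringMonoid.ratFnFunctor := by
  haveI : IsCancelMul d.coveringMonoid.O := d.isCancelMul_coveringMonoid
  exact
    { isMonoidOn := d.coveringMonoid.isMonoidOn_divisorFunctor_of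
        (fun f => d.associatesMap_pull_injective_coveringMonoid f)
      isDivisorial := fun A => d.isDivisorial_divisorFunctor_obj (op A)
      isMonoidOn_rat := d.coveringMonoid.isMonoidOn_ratFnFunctor
      isGroupLike_rat := d.coveringMonoid.isGroupLike_ratFnFunctor
      isGraphConnected := CoveringMonoid.isGraphConnected_cosetCat
      isTotallyEpimorphic := CosetCat.isTotallyEpimorphic }

/-- `Φ` of the genuine monoid is a monoid on `D⊢_v` in the sense of [FrdI] Def 1.1 (ii) (the first clause of
`hypotheses_coveringMonoid`, for consumers that need it alone). [cite: MochizukiFrdI2008, Def. 1.1(ii) p.19] -/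
theorem isMonoidOn_divisorFunctor_coveringMonoid : IsMonoidOn d.coveringMonoid.divisorFunctor :=
  d.hypotheses_coveringMonoid.isMonoidOn

end GaloisValDatum

end Literature.IUT.HodgeTheaters
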